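import Mathlib
import Summits.Parity.GeneralizedHardyLittlewood.Theorems.ParityLeakOneFifthPlainSplitRoughLiouvilleTwistedSmall
import Summits.Parity.GeneralizedHardyLittlewood.Theorems.ParityLeakOneFifthPlainSplitCalibReduction
import Summits.Parity.GeneralizedHardyLittlewood.Theorems.ParityLeakOneFifthParityLeakSieveCensus
import Summits.Parity.GeneralizedHardyLittlewood.Theorems.ParityLeakOneFifthParityLeakSieveCorner
import HarnessLib

/-!
# Route ParityLeakOneFifth, crux `ParityLeakSieve` (stmt-Parity-18381), skeleton `birth`:
# stub S2 `stub_parityDefectZero` — the zero parity defect at `ν = 1/5`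

`Π − δ·x/log x ≤ 𝔐`, where `Π = Σ b λ(n+2) Φ(n+2)` and `𝔐 = Σ b Ψ(n+2)` on `n ∈ (x, 2x]` (route
dictionary: `b = 1[n z-rough]/V`, `Φ = 1[w ≤ P⁻ < y]·G`, `Ψ = 1[y ≤ P⁻]·G`).  Proof:
`VΠ = A_w − A_y` (`sum_liouville_Phi_split`) and `V𝔐 + A_y = Σ_{n z-rough, P⁻(n+2) ≥ y} (1 + λ)G(n+2)`;
pointwise `(1+λ)G ≥ −2·1[Ω = 4]·#{d ∣ m : Ω d = 2, D < d, d² < m} − 64·1[m not squarefree]`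
(`…Census.lean`), the corner count is `≤ (δ/8) V x/log x` (`corner_le`), the non-squarefree shifts
are `O(x^{4/5})`, and `|A_w| ≤ (δ/4) V x/log x` (`stub_roughLiouvilleTwistedSmall`, crux `PlainSplit`).
-/

namespace Summit.Parity.GeneralizedHardyLittlewood.Theorems.ParityLeakOneFifth

open Finset Real
open scoped ArithmeticFunction.Omega ArithmeticFunction.Moebius
open Literature.NumberTheory.Sieve

/-- The pointwise inequality of the model side with the `Ω = 4` indicator: for a `y`-rough `m ≥ 2`
with `Ω m ≤ 5`, `1 ≤ D < y³`, `D² < m` and "`Ω m = 4 ⇒` all prime factors `≤ D`":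
`(1 + λ(m))·G(m) ≥ −2·1[Ω m = 4]·#{d ∣ m : Ω d = 2, D < d, d² < m} − 64·1[m not squarefree]`. -/
theorem onePlusLiouville_truncMoebius_ge' {m : ℕ} {y D : ℝ} (hm2 : 2 ≤ m) (hy : 1 ≤ y) (hD1 : 1 ≤ D)
    (hDy : D < y ^ 3) (hDm : D ^ 2 < m) (hr : ∀ p ∈ m.primeFactors, y ≤ (p : ℝ)) (hΩ5 : Ω m ≤ 5)
    (h4 : Ω m = 4 → ∀ p ∈ m.primeFactors, (p : ℝ) ≤ D) :
    -2 * (if Ω m = 4 then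
        (#((Nat.divisors m).filter (fun d : ℕ => Ω d = 2 ∧ D < (d : ℝ) ∧ d * d < m)) : ℝ) else 0) -
        64 * (if ¬ Squarefree m then 1 else 0) ≤
      (1 + (ArithmeticFunction.liouville m : ℝ)) *
        ∑ d ∈ (Nat.divisors m).filter (fun d : ℕ => (d : ℝ) ≤ D), (μ d : ℝ) := by
  by_cases hΩ4 : Ω m = 4
  · rw [if_pos hΩ4]
    exact onePlusLiouville_truncMoebius_ge hm2 hy hD1 hDy hDm hr hΩ5 h4
  rw [if_neg hΩ4, mul_zero, zero_sub]
  have hm0 : m ≠ 0 := by omega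
  have hDm' : D < m := by nlinarith
  have hlam : (ArithmeticFunction.liouville m : ℝ) = (-1) ^ Ω m := by
    rw [ArithmeticFunction.liouville_apply hm0]; push_cast; ring
  by_cases hsq : Squarefree m
  · rw [if_neg (not_not.2 hsq), mul_zero, neg_zero, truncMoebius_eq hy hDy hD1 hsq hr, hlam]
    set s₁ : ℝ := (#((Nat.divisors m).filter (fun d : ℕ => d.Prime ∧ (d : ℝ) ≤ D)) : ℝ) with hs₁
    set s₂ : ℝ := (#((Nat.divisors m).filter (fun d : ℕ => Ω d = 2 ∧ (d : ℝ) ≤ D)) : ℝ) with hs₂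
    have hΩ1 : 1 ≤ Ω m := by
      rw [← card_primeFactors_eq_cardFactors hsq, Finset.one_le_card]
      exact ⟨m.minFac, Nat.mem_primeFactors.2 ⟨Nat.minFac_prime (by omega), Nat.minFac_dvd m, hm0⟩⟩
    interval_cases hΩm : Ω m
    · norm_num
    · have e2 : s₂ = 0 := by
        rw [hs₂]; exact_mod_cast card_filter_two_divisors_eq_zero hm0 hΩm hDm'
      have e1 : s₁ ≤ 1 := by
        rw [hs₁, card_filter_prime_divisors_of_two hsq hΩm (by linarith) hDm]
        split_ifs <;> norm_num
      rw [e2]; norm_num; linarith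
    · norm_num
    · exact absurd rfl hΩ4
    · norm_num
  · rw [if_pos hsq, mul_one]
    have hG := abs_truncMoebius_le hm0 D
    have h32 : (2 : ℝ) ^ Ω m ≤ 32 := by
      calc (2 : ℝ) ^ Ω m ≤ 2 ^ 5 := pow_le_pow_right₀ (by norm_num) hΩ5
        _ = 32 := by norm_num
    have hlam1 : |1 + (ArithmeticFunction.liouville m : ℝ)| ≤ 2 := by
      rw [hlam]
      rcases neg_one_pow_eq_or ℝ (Ω m) with h | h <;> rw [h] <;> norm_num
    have hprod : |(1 + (ArithmeticFunction.liouville m : ℝ)) *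
        ∑ d ∈ (Nat.divisors m).filter (fun d : ℕ => (d : ℝ) ≤ D), (μ d : ℝ)| ≤ 64 := by
      rw [abs_mul]
      calc _ ≤ 2 * 32 := mul_le_mul hlam1 (hG.trans h32) (abs_nonneg _) (by norm_num)
        _ = 64 := by norm_num
    have h1 := (abs_le.1 hprod).1
    linarith

/-- Growth: for every `κ > 0`, `400 x^{4/5} ≤ κ V x/log x` for large `x` (`V ≥ c/(log log x)⁴`). -/
theorem rpow_four_fifths_le (κ : ℝ) (hκ : 0 < κ) : ∃ x₀ : ℕ, ∀ x : ℕ, x₀ ≤ x → ∀ (z V : ℝ),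
    z = Real.exp (Real.log (Real.log (x : ℝ)) ^ 2) →
    V = ∏ p ∈ (Finset.range ⌈z⌉₊).filter Nat.Prime, (1 - 1 / (p : ℝ)) →
    400 * (x : ℝ) ^ ((4 : ℝ) / 5) ≤ κ * V * (x : ℝ) / Real.log (x : ℝ) := by
  obtain ⟨c, hc, hVlow⟩ := exists_V_lower
  -- `ℓ⁵ ≤ (κ c / 400) e^{ℓ/5}` for `ℓ ≥ L₀`
  set K : ℝ := κ * c / 400 with hK
  have hK0 : 0 < K := by positivity
  set L₀ : ℝ := max 3 (11250000 / K) with hL₀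
  obtain ⟨x₀, hx₀⟩ := exists_nat_loglog_ge (Real.log L₀)
  refine ⟨x₀, fun x hx => ?_⟩
  rintro z V rfl rfl
  obtain ⟨hxE, hlogx, hTt⟩ := hx₀ x hx
  have hL₀3 : (3 : ℝ) ≤ L₀ := le_max_left _ _
  have hL₀0 : 0 < L₀ := by linarith
  rw [Real.exp_log hL₀0] at hlogx
  set ℓ : ℝ := Real.log (x : ℝ) with hℓ
  have hℓ3 : 3 ≤ ℓ := hL₀3.trans hlogx
  have hℓK : 11250000 / K ≤ ℓ := (le_max_right _ _).trans hlogx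
  have hℓ0 : 0 < ℓ := by linarith
  have hx0 : (0 : ℝ) < x := (Real.exp_pos _).trans_le hxE
  have hxℓ : (x : ℝ) = Real.exp ℓ := by rw [hℓ, Real.exp_log hx0]
  set t : ℝ := Real.log ℓ with ht
  have ht1 : 1 ≤ t := by
    rw [ht, Real.le_log_iff_exp_le hℓ0]
    have := Real.exp_one_lt_d9; linarith
  have htℓ : t ≤ ℓ := by rw [ht]; have := Real.log_le_sub_one_of_pos hℓ0; linarith
  set z : ℝ := Real.exp (t ^ 2) with hz
  have hz2 : 2 ≤ z := by
    have h1 : Real.exp 1 ≤ z := Real.exp_le_exp.2 (by nlinarith)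
    have h2 : (2 : ℝ) < Real.exp 1 := by have := Real.exp_one_gt_d9; linarith
    linarith
  have hlogz : Real.log z = t ^ 2 := by rw [hz, Real.log_exp]
  have hVc : c / t ^ 4 ≤ ∏ p ∈ (Finset.range ⌈z⌉₊).filter Nat.Prime, (1 - 1 / (p : ℝ)) := by
    have h := hVlow z hz2; rw [hlogz, show (t ^ 2) ^ 2 = t ^ 4 by ring] at h; exact h
  have ht0 : 0 < t := by linarith
  -- `ℓ⁶ ≤ 720·5⁶ e^{ℓ/5}`
  have h6 : ℓ ^ 6 ≤ 11250000 * Real.exp (ℓ / 5) := by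
    have h := Real.pow_div_factorial_le_exp (ℓ / 5) (by positivity) 6
    rw [div_pow] at h
    norm_num [Nat.factorial] at h
    linarith
  have h5 : ℓ ^ 5 ≤ K * Real.exp (ℓ / 5) := by
    have hKℓ : 11250000 ≤ K * ℓ := by
      have := (div_le_iff₀ hK0).1 hℓK; linarith
    have : ℓ ^ 6 ≤ (K * ℓ) * Real.exp (ℓ / 5) :=
      h6.trans (mul_le_mul_of_nonneg_right hKℓ (Real.exp_pos _).le)
    have e : (K * ℓ) * Real.exp (ℓ / 5) = ℓ * (K * Real.exp (ℓ / 5)) := by ring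
    rw [e, show ℓ ^ 6 = ℓ * ℓ ^ 5 by ring] at this
    exact le_of_mul_le_mul_left this hℓ0
  -- `ℓ t⁴ ≤ ℓ⁵`
  have ht4 : ℓ * t ^ 4 ≤ ℓ ^ 5 := by
    have : t ^ 4 ≤ ℓ ^ 4 := pow_le_pow_left₀ ht0.le htℓ 4
    nlinarith
  -- assemble: `400 x^{4/5} ≤ κ (c/t⁴) x/ℓ ≤ κ V x/ℓ`
  have hx45 : (x : ℝ) ^ ((4 : ℝ) / 5) = Real.exp (4 / 5 * ℓ) := by
    rw [hxℓ, ← Real.exp_mul]; ring_nf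
  have hkey : 400 * Real.exp (4 / 5 * ℓ) ≤ κ * (c / t ^ 4) * Real.exp ℓ / ℓ := by
    rw [le_div_iff₀ hℓ0, show κ * (c / t ^ 4) * Real.exp ℓ = (κ * c) * Real.exp ℓ / t ^ 4 by ring,
      le_div_iff₀ (by positivity)]
    have hsplit : Real.exp ℓ = Real.exp (ℓ / 5) * Real.exp (4 / 5 * ℓ) := by
      rw [← Real.exp_add]; ring_nf
    rw [hsplit]
    have h7 : ℓ * t ^ 4 ≤ K * Real.exp (ℓ / 5) := ht4.trans h5
    have h8 := mul_le_mul_of_nonneg_right h7 (Real.exp_pos (4 / 5 * ℓ)).le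
    rw [hK] at h8
    have e : κ * c / 400 * Real.exp (ℓ / 5) * Real.exp (4 / 5 * ℓ) * 400 =
        κ * c * (Real.exp (ℓ / 5) * Real.exp (4 / 5 * ℓ)) := by ring
    nlinarith [h8, Real.exp_pos (4 / 5 * ℓ)]
  rw [hx45, hxℓ]
  refine hkey.trans ?_
  have : κ * (c / t ^ 4) * Real.exp ℓ / ℓ ≤ κ * (∏ p ∈ (Finset.range ⌈z⌉₊).filter Nat.Prime,
      (1 - 1 / (p : ℝ))) * Real.exp ℓ / ℓ := by
    refine div_le_div_of_nonneg_right ?_ hℓ0.le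
    exact mul_le_mul_of_nonneg_right (mul_le_mul_of_nonneg_left hVc hκ.le) (Real.exp_pos _).le
  exact this

/-- The arithmetic of `stub_parityDefectZero` over real variables. -/
theorem parityDefect_arith {Aw Ay My Co Nsq V X δ : ℝ} (hA : |Aw| ≤ δ / 4 * V * X)
    (hpt : -2 * Co - 64 * Nsq ≤ My + Ay) (hCo : Co ≤ δ / 8 * V * X) (hN : 64 * Nsq ≤ δ / 4 * V * X)
    (hδ : 0 ≤ δ) (hV : 0 ≤ V) (hX : 0 ≤ X) :
    Aw - Ay - δ * V * X ≤ My := by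
  have h1 := (abs_le.1 hA).2
  have h0 : 0 ≤ δ * V * X := by positivity
  linarith

set_option maxHeartbeats 1600000 in
/-- The parametric form of stub S2: for `δ > 0`, `0 < ε ≤ ε₂(δ)`, `x ≥ x₀(ε)`,
`Σ_n b(n) λ(n+2) Φ(n+2) − δ x/log x ≤ Σ_n b(n) Ψ(n+2)` with the route's dictionary supplied as
equations. -/
theorem parityDefect_param : ∀ δ : ℝ, 0 < δ → ∃ ε₂ : ℝ, 0 < ε₂ ∧ ∀ ε : ℝ, 0 < ε → ε ≤ ε₂ →
    ∃ x₀ : ℕ, ∀ x : ℕ, x₀ ≤ x → ∀ (z V : ℝ) (G : ℕ → ℝ),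
      z = Real.exp (Real.log (Real.log (x : ℝ)) ^ 2) →
      V = ∏ p ∈ (Finset.range ⌈z⌉₊).filter Nat.Prime, (1 - 1 / (p : ℝ)) →
      G = (fun m : ℕ => ∑ d ∈ (Nat.divisors m).filter (fun d : ℕ => (d : ℝ) ≤ (x : ℝ) ^ ((1 : ℝ) / 2 - 2 * ε) ∧
        ∀ p ∈ d.primeFactors, (x : ℝ) ^ ((1 : ℝ) / 5) ≤ (p : ℝ)), (ArithmeticFunction.moebius d : ℝ)) →
      (∑ n ∈ Finset.Ioc x (2 * x), (if ∀ p ∈ n.primeFactors, z ≤ (p : ℝ) then 1 / V else 0) *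
          (ArithmeticFunction.liouville (n + 2) : ℝ) *
          (if (x : ℝ) ^ (ε ^ 2) ≤ ((n + 2).minFac : ℝ) ∧ ((n + 2).minFac : ℝ) < (x : ℝ) ^ ((1 : ℝ) / 5)
            then G (n + 2) else 0)) - δ * (x : ℝ) / Real.log (x : ℝ) ≤
      ∑ n ∈ Finset.Ioc x (2 * x), (if ∀ p ∈ n.primeFactors, z ≤ (p : ℝ) then 1 / V else 0) *
          (if (x : ℝ) ^ ((1 : ℝ) / 5) ≤ ((n + 2).minFac : ℝ) then G (n + 2) else 0) := by
  intro δ hδ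
  obtain ⟨ε₀, hε₀, hA⟩ := stub_roughLiouvilleTwistedSmall (δ / 4) (by positivity)
  obtain ⟨ε₁, hε₁, hC⟩ := corner_le (δ / 8) (by positivity)
  obtain ⟨x₃, hx₃⟩ := rpow_four_fifths_le (δ / 4) (by positivity)
  obtain ⟨c, hc, hVlow⟩ := exists_V_lower
  refine ⟨min ε₀ (min ε₁ (1 / 25)), by positivity, fun ε hε hεle => ?_⟩
  have hεε₀ : ε ≤ ε₀ := hεle.trans (min_le_left _ _)
  have hεε₁ : ε ≤ ε₁ := hεle.trans ((min_le_right _ _).trans (min_le_left _ _))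
  have hε25 : ε ≤ 1 / 25 := hεle.trans ((min_le_right _ _).trans (min_le_right _ _))
  obtain ⟨x₁, hx₁⟩ := hA ε hε hεε₀
  obtain ⟨x₂, hx₂⟩ := hC ε hε hεε₁
  obtain ⟨x₄, hx₄⟩ := exists_nat_loglog_ge 1
  refine ⟨max (max x₁ x₂) (max (max x₃ x₄) (2 ^ 100)), fun x hx => ?_⟩
  rintro z V G rfl rfl hG
  have hxx₁ : x₁ ≤ x := ((le_max_left _ _).trans (le_max_left _ _)).trans hx
  have hxx₂ : x₂ ≤ x := ((le_max_right _ _).trans (le_max_left _ _)).trans hx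
  have hxx₃ : x₃ ≤ x := (((le_max_left _ _).trans (le_max_left _ _)).trans (le_max_right _ _)).trans hx
  have hxx₄ : x₄ ≤ x := (((le_max_right _ _).trans (le_max_left _ _)).trans (le_max_right _ _)).trans hx
  have hx100 : 2 ^ 100 ≤ x := ((le_max_right _ _).trans (le_max_right _ _)).trans hx
  obtain ⟨hy1, hD1, hwy, hDy3, hD2x, hyx, hy6, hDy, hnum⟩ := calib_growth hε hε25 hx100
  obtain ⟨hxE, -, hTt⟩ := hx₄ x hxx₄
  set t : ℝ := Real.log (Real.log (x : ℝ)) with ht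
  have ht1 : 1 ≤ t := hTt
  set z : ℝ := Real.exp (t ^ 2) with hz
  have hz2 : 2 < z := by
    have h1 : Real.exp 1 ≤ z := Real.exp_le_exp.2 (by nlinarith)
    have h2 : (2 : ℝ) < Real.exp 1 := by have := Real.exp_one_gt_d9; linarith
    linarith
  have hlogz : Real.log z = t ^ 2 := by rw [hz, Real.log_exp]
  set V : ℝ := ∏ p ∈ (Finset.range ⌈z⌉₊).filter Nat.Prime, (1 - 1 / (p : ℝ)) with hV
  have hVc : c / t ^ 4 ≤ V := by
    have h := hVlow z hz2.le; rw [hlogz, show (t ^ 2) ^ 2 = t ^ 4 by ring] at h; exact h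
  have hV0 : 0 < V := lt_of_lt_of_le (by positivity) hVc
  have hx0 : (0 : ℝ) < x := (Real.exp_pos _).trans_le hxE
  set y : ℝ := (x : ℝ) ^ ((1 : ℝ) / 5) with hy
  set D : ℝ := (x : ℝ) ^ ((1 : ℝ) / 2 - 2 * ε) with hD
  set w : ℝ := (x : ℝ) ^ (ε ^ 2) with hw
  have hy0 : 0 < y := by linarith
  set X : ℝ := (x : ℝ) / Real.log (x : ℝ) with hX
  -- the inputs at this `x`
  have hA' := hx₁ x hxx₁ z V G rfl rfl hG
  have hC' := hx₂ x hxx₂ z V rfl rfl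
  have hG45 := hx₃ x hxx₃ z V rfl rfl
  -- rewrite the model sums as `(1/V)·Σ_{rough}`
  set R : ℕ → Prop := fun n => ∀ p ∈ n.primeFactors, z ≤ (p : ℝ) with hR
  have hL : ∑ n ∈ Finset.Ioc x (2 * x), (if R n then 1 / V else 0) *
      (ArithmeticFunction.liouville (n + 2) : ℝ) *
      (if w ≤ ((n + 2).minFac : ℝ) ∧ ((n + 2).minFac : ℝ) < y then G (n + 2) else 0) =
      (1 / V) * ∑ n ∈ (Finset.Ioc x (2 * x)).filter (fun n => R n),
        (ArithmeticFunction.liouville (n + 2) : ℝ) *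
        (if w ≤ ((n + 2).minFac : ℝ) ∧ ((n + 2).minFac : ℝ) < y then G (n + 2) else 0) :=
    sum_model_mul_eq x z V (fun m => if w ≤ (m.minFac : ℝ) ∧ (m.minFac : ℝ) < y then G m else 0)
  have hRsum : ∑ n ∈ Finset.Ioc x (2 * x), (if R n then 1 / V else 0) *
      (if y ≤ ((n + 2).minFac : ℝ) then G (n + 2) else 0) =
      (1 / V) * ∑ n ∈ (Finset.Ioc x (2 * x)).filter (fun n => R n ∧ y ≤ ((n + 2).minFac : ℝ)),
        G (n + 2) := by
    rw [Finset.mul_sum, Finset.sum_filter]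
    refine Finset.sum_congr rfl fun n _ => ?_
    by_cases h1 : R n
    · by_cases h2 : y ≤ ((n + 2).minFac : ℝ)
      · have hc : (R n ∧ y ≤ ((n + 2).minFac : ℝ)) := ⟨h1, h2⟩
        simp only [if_pos h1, if_pos h2, if_pos hc]
      · have hc : ¬ (R n ∧ y ≤ ((n + 2).minFac : ℝ)) := fun h => h2 h.2
        simp only [if_pos h1, if_neg h2, if_neg hc, mul_zero]
    · have hc : ¬ (R n ∧ y ≤ ((n + 2).minFac : ℝ)) := fun h => h1 h.1
      simp only [if_neg h1, if_neg hc, zero_mul]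
  rw [hL, hRsum, sum_liouville_Phi_split (Finset.Ioc x (2 * x)) R w y hwy G]
  -- the pieces
  set Aw : ℝ := ∑ n ∈ (Finset.Ioc x (2 * x)).filter (fun n => R n ∧ w ≤ ((n + 2).minFac : ℝ)),
    (ArithmeticFunction.liouville (n + 2) : ℝ) * G (n + 2) with hAw
  set Ay : ℝ := ∑ n ∈ (Finset.Ioc x (2 * x)).filter (fun n => R n ∧ y ≤ ((n + 2).minFac : ℝ)),
    (ArithmeticFunction.liouville (n + 2) : ℝ) * G (n + 2) with hAy
  set My : ℝ := ∑ n ∈ (Finset.Ioc x (2 * x)).filter (fun n => R n ∧ y ≤ ((n + 2).minFac : ℝ)),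
    G (n + 2) with hMy
  set F := (Finset.Ioc x (2 * x)).filter (fun n => R n ∧ y ≤ ((n + 2).minFac : ℝ)) with hF
  -- the pointwise inequality summed over `F`
  have hpt : ∀ n ∈ F, -2 * (if Ω (n + 2) = 4 then
      (#((Nat.divisors (n + 2)).filter (fun d : ℕ => Ω d = 2 ∧ D < (d : ℝ) ∧ d * d < n + 2)) : ℝ) else 0) -
      64 * (if ¬ Squarefree (n + 2) then 1 else 0) ≤
      G (n + 2) + (ArithmeticFunction.liouville (n + 2) : ℝ) * G (n + 2) := by
    intro n hn
    rw [hF, Finset.mem_filter, Finset.mem_Ioc] at hn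
    obtain ⟨⟨hn1, hn2⟩, -, hmf⟩ := hn
    have hm0 : n + 2 ≠ 0 := by omega
    have hrm : ∀ p ∈ (n + 2).primeFactors, y ≤ (p : ℝ) := by
      intro p hp
      have h := Nat.minFac_le_of_dvd (Nat.prime_of_mem_primeFactors hp).two_le
        (Nat.dvd_of_mem_primeFactors hp)
      exact hmf.trans (by exact_mod_cast h)
    have hGm : G (n + 2) = ∑ d ∈ (Nat.divisors (n + 2)).filter (fun d : ℕ => (d : ℝ) ≤ D),
        (μ d : ℝ) := by
      rw [hG]; simp only []; rw [filter_divisors_rough_eq hrm hm0]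
    have hmx : ((n + 2 : ℕ) : ℝ) ≤ 2 * (x : ℝ) + 2 := by
      have : n + 2 ≤ 2 * x + 2 := by omega
      exact_mod_cast this
    have hmx' : (x : ℝ) < ((n + 2 : ℕ) : ℝ) := by
      have : x < n + 2 := by omega
      exact_mod_cast this
    have e : G (n + 2) + (ArithmeticFunction.liouville (n + 2) : ℝ) * G (n + 2) =
        (1 + (ArithmeticFunction.liouville (n + 2) : ℝ)) * G (n + 2) := by ring
    rw [e, hGm]
    refine onePlusLiouville_truncMoebius_ge' (y := y) (by omega) hy1 hD1 hDy3 (by linarith) hrm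
      (cardFactors_le_five_of_rough hm0 hy1 hrm (by linarith)) ?_
    intro h4 p hp
    have hpp := Nat.prime_of_mem_primeFactors hp
    have hpd := Nat.dvd_of_mem_primeFactors hp
    refine le_of_cofactor_three hm0 hy0 hpd hrm ?_ (by linarith)
    have hk0 : (n + 2) / p ≠ 0 := by
      intro h; exact hm0 (by rw [← Nat.mul_div_cancel' hpd, h, mul_zero])
    have e' := ArithmeticFunction.cardFactors_mul (m := p) (n := (n + 2) / p) hpp.ne_zero hk0
    rw [Nat.mul_div_cancel' hpd, ArithmeticFunction.cardFactors_apply_prime hpp] at e'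
    omega
  have hsumF := Finset.sum_le_sum hpt
  rw [Finset.sum_sub_distrib, ← Finset.mul_sum, ← Finset.mul_sum, Finset.sum_add_distrib,
    ← Finset.sum_filter, sum_ite_one_eq_card] at hsumF
  -- the corner sum is the one of `corner_le`
  have hcornerEq : ∑ n ∈ F.filter (fun n => Ω (n + 2) = 4),
      (#((Nat.divisors (n + 2)).filter (fun d : ℕ => Ω d = 2 ∧ D < (d : ℝ) ∧ d * d < n + 2)) : ℝ) =
      ∑ n ∈ (Finset.Ioc x (2 * x)).filter (fun n : ℕ => (∀ p ∈ n.primeFactors, z ≤ (p : ℝ)) ∧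
          y ≤ ((n + 2).minFac : ℝ) ∧ ArithmeticFunction.cardFactors (n + 2) = 4),
        (#((Nat.divisors (n + 2)).filter (fun d : ℕ => ArithmeticFunction.cardFactors d = 2 ∧
            D < (d : ℝ) ∧ d * d < n + 2)) : ℝ) := by
    refine Finset.sum_congr ?_ fun _ _ => rfl
    rw [hF, Finset.filter_filter]
    refine Finset.filter_congr fun n _ => ?_
    simp only [hR, and_assoc]
  rw [hcornerEq] at hsumF
  -- the non-squarefree count
  have hNs : F.filter (fun n : ℕ => ¬ Squarefree (n + 2)) ⊆
      (Finset.Ioc x (2 * x)).filter (fun n : ℕ => ¬ Squarefree (n + 2) ∧ y ≤ ((n + 2).minFac : ℝ)) := by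
    intro n hn
    rw [Finset.mem_filter, hF, Finset.mem_filter] at hn
    rw [Finset.mem_filter]
    exact ⟨hn.1.1, hn.2, hn.1.2.2⟩
  have hN : (#(F.filter (fun n : ℕ => ¬ Squarefree (n + 2))) : ℝ) ≤
      2 * (x : ℝ) / y + Nat.sqrt (2 * x + 2) + 1 := by
    refine le_trans ?_ (card_nonSquarefree_rough_le x hy1)
    exact_mod_cast Finset.card_le_card hNs
  have hN' : 64 * (#(F.filter (fun n : ℕ => ¬ Squarefree (n + 2))) : ℝ) ≤ δ / 4 * V * X := by
    have h1 : 64 * (2 * (x : ℝ) / y + Nat.sqrt (2 * x + 2) + 1) ≤ 400 * (x : ℝ) ^ ((4 : ℝ) / 5) := by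
      linarith
    have h2 : 400 * (x : ℝ) ^ ((4 : ℝ) / 5) ≤ δ / 4 * V * X := by rw [hX, ← mul_div_assoc]; exact hG45
    linarith
  have hC'' : ∑ n ∈ (Finset.Ioc x (2 * x)).filter (fun n : ℕ => (∀ p ∈ n.primeFactors, z ≤ (p : ℝ)) ∧
      y ≤ ((n + 2).minFac : ℝ) ∧ ArithmeticFunction.cardFactors (n + 2) = 4),
      (#((Nat.divisors (n + 2)).filter (fun d : ℕ => ArithmeticFunction.cardFactors d = 2 ∧
          D < (d : ℝ) ∧ d * d < n + 2)) : ℝ) ≤ δ / 8 * V * X := by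
    rw [hX, ← mul_div_assoc]; exact hC'
  have hA'' : |Aw| ≤ δ / 4 * V * X := by rw [hX, ← mul_div_assoc]; exact hA'
  -- assemble
  have key := parityDefect_arith hA'' hsumF hC'' hN' hδ.le hV0.le (by positivity)
  have hVne : V ≠ 0 := hV0.ne'
  rw [hX] at key
  have e1 : 1 / V * (Aw - Ay) - δ * (x : ℝ) / Real.log (x : ℝ) = (1 / V) * (Aw - Ay - δ * V * ((x : ℝ) / Real.log (x : ℝ))) := by
    field_simp
  rw [e1]
  exact mul_le_mul_of_nonneg_left key (by positivity)

/-- **Stub S2 `stub_parityDefectZero`** of skeleton `birth` (crux `ParityLeakSieve`,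
stmt-Parity-18381), verbatim: the zero parity defect of the `(W1)` weight at `ν = 1/5` on the model,
`Π − δ x/log x ≤ 𝔐` for `0 < ε ≤ ε₂(δ)` and `x ≥ x₀(ε)`. -/
theorem stub_parityDefectZero : ∀ δ : ℝ, 0 < δ → ∃ ε₂ : ℝ, 0 < ε₂ ∧ ∀ ε : ℝ, 0 < ε → ε ≤ ε₂ → ∃ x₀ : ℕ, ∀ x : ℕ, x₀ ≤ x → (fun (b Φ Ψ : ℕ → ℝ) => (∑ n ∈ Finset.Ioc x (2 * x), b n * (ArithmeticFunction.liouville (n + 2) : ℝ) * Φ (n + 2)) - δ * (x : ℝ) / Real.log (x : ℝ) ≤ (∑ n ∈ Finset.Ioc x (2 * x), b n * Ψ (n + 2))) (fun n : ℕ => if ∀ p ∈ n.primeFactors, Real.exp (Real.log (Real.log (x : ℝ)) ^ 2) ≤ (p : ℝ) then 1 / (∏ p ∈ (Finset.range ⌈Real.exp (Real.log (Real.log (x : ℝ)) ^ 2)⌉₊).filter Nat.Prime, (1 - 1 / (p : ℝ))) else 0) (fun m : ℕ => if (x : ℝ) ^ (ε ^ 2) ≤ (m.minFac : ℝ) ∧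 (m.minFac : ℝ) < (x : ℝ) ^ ((1 : ℝ) / 5) then ∑ d ∈ (Nat.divisors m).filter (fun d : ℕ => (d : ℝ) ≤ (x : ℝ) ^ ((1 : ℝ) / 2 - 2 * ε) ∧ ∀ p ∈ d.primeFactors, (x : ℝ) ^ ((1 : ℝ) / 5) ≤ (p : ℝ)), (ArithmeticFunction.moebius d : ℝ) else 0) (fun m : ℕ => if (x : ℝ) ^ ((1 : ℝ) / 5) ≤ (m.minFac : ℝ) then ∑ d ∈ (Nat.divisors m).filter (fun d : ℕ => (d : ℝ) ≤ (x : ℝ) ^ ((1 : ℝ) / 2 - 2 * ε) ∧ ∀ p ∈ d.primeFactors, (x : ℝ) ^ ((1 : ℝ) / 5) ≤ (p : ℝ)), (ArithmeticFunction.moebius d : ℝ) else 0) := by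
  intro δ hδ
  obtain ⟨ε₂, hε₂, h⟩ := parityDefect_param δ hδ
  refine ⟨ε₂, hε₂, fun ε hε hεle => ?_⟩
  obtain ⟨x₀, hx₀⟩ := h ε hε hεle
  refine ⟨x₀, fun x hx => ?_⟩
  beta_reduce
  exact hx₀ x hx _ _ (fun m : ℕ => ∑ d ∈ (Nat.divisors m).filter (fun d : ℕ =>
    (d : ℝ) ≤ (x : ℝ) ^ ((1 : ℝ) / 2 - 2 * ε) ∧ ∀ p ∈ d.primeFactors, (x : ℝ) ^ ((1 : ℝ) / 5) ≤ (p : ℝ)),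
      (ArithmeticFunction.moebius d : ℝ)) rfl rfl rfl

end Summit.Parity.GeneralizedHardyLittlewood.Theorems.ParityLeakOneFifth
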